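/-
Copyright: the b2b-balaban cell (near-miss cell 7), T⁴-continuum fan-out, lineage t4-ne7b-p2 (node U5c RENEWAL member).
Released under the licence of the surrounding project.
-/
import Mathlib.Analysis.SpecialFunctions.Log.Basic
import Mathlib.Analysis.Complex.ExponentialBounds

/-!
# The renewal route's tilts and slack (leaf N3e): run tilt, banking tilt, defect `η = 1∕2`, catalogue room `εc ≤ 1∕4`

Summits-side support leaf of the T⁴-continuum cell (rung (B)+1 on a FINITE torus only; NOT infinite volume, NOT the
mass gap, NOT the Clay statement; NOT a proof of the spine estimate NE7b).  Lineage `t4-ne7b-p2` (generation 23),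
node U5c, RENEWAL route; leaf N3e (tilt ∕ slack arithmetic) of the ROUND-2 skeleton `t4/skeletons/NE7b-t4-ne7b-p2.md`
v1.7.  [folklore] real arithmetic (`Real.exp`, `Real.log`); nothing is quoted from print, nothing printed is asserted,
no `[cite:]` tag; none of the cell's conditionals ((B), BetaPertH) occurs.  The survival condition of the node
(«p₀(g)∕N > 4 log L·(1 + o(1))», the cell's reading of B16 p. 361) enters the renewal forest ONLY through the shape
`Λ = L⁴ < z < z₁ = e^{κ₁}` below; WHICH `κ₁` the printed credits afford is leaf S1∕S4 (flow + constants), not this file.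

WHAT.  The three numbers the renewal forest (`RenewalGroveSum.sum_le_of_grove_product`, `RenewalRecordsEnd`) and the
slot gas (`RenewalSlotGas.exists_relWeightBound_of_slotMasses`) ask for: a RUN TILT `z` with `1 ≤ z` and
`Λ·z⁻¹ < 1` (`Λ = L⁴` the cell-count growth per step of age), a BANKING TILT `z₁ > z`, and a SLACK
`εc·(z∕z₁)∕(1 − z∕z₁) ≤ 1 − η` with `η > 0`.  CHOICE: `z := L⁴·e^{1∕2}` (`runTilt`), `κ₁ := 4 log L + η̄ + 1`
(`kappa₁`, `η̄ ≥ 0` the spare credit rate), `z₁ := e^{κ₁} = L⁴·e^{η̄ + 1}` (`bankTilt`), `η := 1∕2`.  THEN (§2):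
`1 ≤ z`, `z < z₁`, `Λ·z⁻¹ = e^{−1∕2} < 1`, `z∕z₁ ≤ e^{−1∕2} ≤ 2∕3`, the forest constant `1∕(1 − z₁⁻¹z) ≤ 3`, and the
slack holds as soon as the one-event catalogue mass is `εc ≤ 1∕4` (`slack_of_le_quarter`) — the IR-threshold target of
leaf N3 (`εr + εm + εa ≤ 1∕4`).  §3 decided numerics.

HONEST DEPENDENCY (cell): continuum YM on T⁴ ⇐ BetaPertH ∧ nine spine estimates (0/9 proved); BetaPertH ⇐ (D1) ∧ (D4)
∧ CAP+tail.  This file changes none of it.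
-/

namespace Summit.QuantumFields.BalabanUV.T4Continuum.RenewalTilts

noncomputable section

open Real

/-! ## §1 The choices -/

/-- the cell-count growth per step of age on the four-torus: `Λ = L⁴` [folklore] -/
def growth (L : ℝ) : ℝ := L ^ 4

/-- **THE RUN TILT** `z := L⁴·e^(1∕2)` (age decay rate `σ = z⁻¹`, so `Λσ = e^(−1∕2) < 1`). [folklore] -/
def runTilt (L : ℝ) : ℝ := L ^ 4 * exp (1 / 2)

/-- **THE PAIRING RATE** `κ₁ := 4 log L + η̄ + 1` (`η̄ ≥ 0` the spare credit rate beyond the survival threshold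
`4 log L`). [folklore] -/
def kappa₁ (L ηbar : ℝ) : ℝ := 4 * log L + ηbar + 1

/-- **THE BANKING TILT** `z₁ := e^(κ₁)`. [folklore] -/
def bankTilt (L ηbar : ℝ) : ℝ := exp (kappa₁ L ηbar)

/-- **THE DEFECT** `η := 1∕2`. [folklore] -/
def defect : ℝ := 1 / 2

/-! ## §2 The inequalities the forest and the gas ask for -/

/-- `e^(4 log L) = L⁴` (`0 < L`) [folklore] -/
theorem exp_four_log {L : ℝ} (hL : 0 < L) : exp (4 * log L) = L ^ 4 := by
  rw [show (4 : ℝ) * log L = ((4 : ℕ) : ℝ) * log L by norm_num, ← log_pow, exp_log (pow_pos hL 4)]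

/-- the banking tilt in closed form: `e^(4 log L + η̄ + 1) = L⁴·e^(η̄ + 1)` (`0 < L`) [folklore] -/
theorem bankTilt_eq {L : ℝ} (hL : 0 < L) (ηbar : ℝ) : bankTilt L ηbar = L ^ 4 * exp (ηbar + 1) := by
  unfold bankTilt kappa₁
  rw [show 4 * log L + ηbar + 1 = 4 * log L + (ηbar + 1) by ring, exp_add, exp_four_log hL]

/-- `1 ≤ z` (`1 ≤ L`) [folklore] -/
theorem one_le_runTilt {L : ℝ} (hL : 1 ≤ L) : 1 ≤ runTilt L := by
  unfold runTilt
  have h1 : (1 : ℝ) ≤ L ^ 4 := one_le_pow₀ hL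
  have h2 : (1 : ℝ) ≤ exp (1 / 2) := one_le_exp (by norm_num)
  nlinarith

/-- `0 < z` (`0 < L`) [folklore] -/
theorem runTilt_pos {L : ℝ} (hL : 0 < L) : 0 < runTilt L :=
  mul_pos (pow_pos hL 4) (exp_pos _)

/-- the ratio of the two tilts: `z∕z₁ = e^(1∕2 − (η̄ + 1))` (`0 < L`) [folklore] -/
theorem ratio_eq {L : ℝ} (hL : 0 < L) (ηbar : ℝ) : runTilt L / bankTilt L ηbar = exp (1 / 2 - (ηbar + 1)) := by
  rw [bankTilt_eq hL, runTilt, exp_sub, mul_div_mul_left _ _ (pow_pos hL 4).ne']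

/-- `z∕z₁ ≤ e^(−1∕2)` (`η̄ ≥ 0`) [folklore] -/
theorem ratio_le_exp_neg_half {L ηbar : ℝ} (hL : 0 < L) (hη : 0 ≤ ηbar) :
    runTilt L / bankTilt L ηbar ≤ exp (-(1 / 2)) := by
  rw [ratio_eq hL]
  exact exp_le_exp.2 (by linarith)

/-- `e^(−1∕2) ≤ 2∕3` (from `1 + 1∕2 ≤ e^(1∕2)`) [folklore] -/
theorem exp_neg_half_le : exp (-(1 / 2)) ≤ 2 / 3 := by
  have h : (1 : ℝ) + 1 / 2 ≤ exp (1 / 2) := by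
    have := add_one_le_exp (1 / 2 : ℝ); linarith
  rw [exp_neg, inv_le_comm₀ (exp_pos _) (by norm_num)]
  linarith

/-- `z < z₁` (`0 < L`, `η̄ ≥ 0`) [folklore] -/
theorem runTilt_lt_bankTilt {L ηbar : ℝ} (hL : 0 < L) (hη : 0 ≤ ηbar) : runTilt L < bankTilt L ηbar := by
  have hb : 0 < bankTilt L ηbar := exp_pos _
  have h := ratio_le_exp_neg_half hL hη
  have h1 : exp (-(1 / 2) : ℝ) < 1 := exp_lt_one_iff.2 (by norm_num)
  have h2 : runTilt L / bankTilt L ηbar < 1 := h.trans_lt h1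
  rwa [div_lt_one hb] at h2

/-- **THE GAS RATE**: `Λ·z⁻¹ = e^(−1∕2)` (`0 < L`) [folklore] -/
theorem growth_mul_inv_runTilt {L : ℝ} (hL : 0 < L) : growth L * (runTilt L)⁻¹ = exp (-(1 / 2)) := by
  unfold growth runTilt
  rw [mul_inv, ← mul_assoc, mul_inv_cancel₀ (pow_pos hL 4).ne', one_mul, exp_neg]

/-- … hence `Λ·z⁻¹ < 1` — the condition `Λσ < 1` of `RenewalSlotGas` [folklore] -/
theorem growth_mul_inv_runTilt_lt_one {L : ℝ} (hL : 0 < L) : growth L * (runTilt L)⁻¹ < 1 := by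
  rw [growth_mul_inv_runTilt hL]
  exact exp_lt_one_iff.2 (by norm_num)

/-- **THE FOREST CONSTANT**: `1∕(1 − z₁⁻¹·z) ≤ 3` (`0 < L`, `η̄ ≥ 0`) [folklore] -/
theorem forestConst_le_three {L ηbar : ℝ} (hL : 0 < L) (hη : 0 ≤ ηbar) :
    1 / (1 - (bankTilt L ηbar)⁻¹ * runTilt L) ≤ 3 := by
  have hr : (bankTilt L ηbar)⁻¹ * runTilt L = runTilt L / bankTilt L ηbar := by rw [div_eq_mul_inv, mul_comm]
  rw [hr]
  have h := (ratio_le_exp_neg_half hL hη).trans exp_neg_half_le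
  have hpos : 0 < 1 - runTilt L / bankTilt L ηbar := by linarith
  rw [div_le_iff₀ hpos]
  linarith

/-- **THE SLACK FROM A QUARTER**: if the one-event catalogue mass is `εc ≤ 1∕4` then
`εc·((z∕z₁)∕(1 − z∕z₁)) ≤ 1 − η` with `η = 1∕2` (`0 < L`, `η̄ ≥ 0`). [folklore] -/
theorem slack_of_le_quarter {L ηbar εc : ℝ} (hL : 0 < L) (hη : 0 ≤ ηbar) (hε : εc ≤ 1 / 4) :
    εc * ((runTilt L / bankTilt L ηbar) / (1 - runTilt L / bankTilt L ηbar)) ≤ 1 - defect := by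
  have h := (ratio_le_exp_neg_half hL hη).trans exp_neg_half_le
  have hq0 : 0 ≤ runTilt L / bankTilt L ηbar := div_nonneg (runTilt_pos hL).le (exp_pos _).le
  have hpos : 0 < 1 - runTilt L / bankTilt L ηbar := by linarith
  have hfrac : (runTilt L / bankTilt L ηbar) / (1 - runTilt L / bankTilt L ηbar) ≤ 2 := by
    rw [div_le_iff₀ hpos]; linarith
  unfold defect
  calc εc * ((runTilt L / bankTilt L ηbar) / (1 - runTilt L / bankTilt L ηbar)) ≤ (1 / 4) * 2 :=
        mul_le_mul hε hfrac (div_nonneg hq0 hpos.le) (by norm_num)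
    _ = 1 - 1 / 2 := by norm_num

/-- **THE SURVIVAL SHAPE BY NAME**: `Λ < z₁ ↔ 4 log L < κ₁` (`0 < L`; cf. `T4PersistenceRenewal.rate_window_iff`), and it
HOLDS for `κ₁ = 4 log L + η̄ + 1`, `η̄ ≥ 0`. [folklore] -/
theorem growth_lt_bankTilt {L ηbar : ℝ} (hL : 0 < L) (hη : 0 ≤ ηbar) :
    (growth L < bankTilt L ηbar ↔ 4 * log L < kappa₁ L ηbar) ∧ growth L < bankTilt L ηbar := by
  have hg : growth L = exp (4 * log L) := by
    unfold growth; rw [exp_four_log hL]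
  refine ⟨by rw [hg, bankTilt, exp_lt_exp], ?_⟩
  rw [hg, bankTilt, exp_lt_exp, kappa₁]
  linarith

/-- **THE PER-SLOT CONSTANT**: with `η = 1∕2` and forest constant `≤ 3`, `C_F = B₀·(1∕(1 − z₁⁻¹z))∕η ≤ 6·B₀`
(`B₀ ≥ 0`). [folklore] -/
theorem slotConst_le {L ηbar B₀ : ℝ} (hL : 0 < L) (hη : 0 ≤ ηbar) (hB : 0 ≤ B₀) :
    B₀ * (1 / (1 - (bankTilt L ηbar)⁻¹ * runTilt L)) / defect ≤ 6 * B₀ := by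
  have h := forestConst_le_three hL hη
  unfold defect
  rw [div_eq_mul_inv, show ((1 : ℝ) / 2)⁻¹ = 2 by norm_num]
  nlinarith [mul_le_mul_of_nonneg_left h hB]

/-! ## §3 Decided numerics: at `L = 2`, `η̄ = 0` the window is `Λ = 16 < z ≈ 26.4 < z₁ = 16e ≈ 43.5` -/

/-- the rational skeleton of the choices at `L = 2`: `Λ = 16`; with `e^(1∕2) ∈ (1.6, 1.7)` and `e ∈ (2.7, 2.8)`,
`z ∈ (25.6, 27.2)` and `z₁ ∈ (43.2, 44.8)`; slack room `(1∕4)·2 = 1∕2` [folklore] -/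
example : (2 : ℚ) ^ 4 = 16 ∧ (16 : ℚ) * 1.6 = 25.6 ∧ (16 : ℚ) * 1.7 = 27.2 ∧ (16 : ℚ) * 2.7 = 43.2 ∧
    (16 : ℚ) * 2.8 = 44.8 ∧ (1 : ℚ) / 4 * 2 = 1 - 1 / 2 := by norm_num

/-- `e^(1∕2) < 1.7` and `1.6 < e^(1∕2)` (from `e ∈ (2.7182818283, 2.7182818286)`) [folklore] -/
example : exp (1 / 2) < 1.7 ∧ 1.6 < exp (1 / 2) := by
  have h1 := exp_one_lt_d9
  have h2 := exp_one_gt_d9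
  have hsq : exp (1 / 2) * exp (1 / 2) = exp 1 := by rw [← exp_add]; norm_num
  have hpos : 0 < exp (1 / 2 : ℝ) := exp_pos _
  constructor
  · nlinarith
  · nlinarith

end

end Summit.QuantumFields.BalabanUV.T4Continuum.RenewalTilts
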